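import Mathlib
import Summits.ResolutionOfSingularities.ResolutionOfSingularities.Theorems.WeightedInvariantLocalWeightedDropWildMonicFlagDropAxisN0Parent
import Summits.ResolutionOfSingularities.ResolutionOfSingularities.Theorems.WeightedInvariantLocalWeightedDropWildMonicFlagDropAxisN0ChildMax
import Summits.ResolutionOfSingularities.ResolutionOfSingularities.Theorems.WeightedInvariantLocalWeightedDropWildMonicFlagDropAxisN0Setting
import Summits.ResolutionOfSingularities.ResolutionOfSingularities.Theorems.WeightedInvariantLocalWeightedDropWildMonicFlagDropFacePoint
import Summits.ResolutionOfSingularities.ResolutionOfSingularities.Theorems.WeightedInvariantLocalWeightedDropWildMonicFlagCompanionReading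
import Summits.ResolutionOfSingularities.ResolutionOfSingularities.Theorems.WeightedInvariantLocalWeightedDropWildMonicSCleanAxisSucc
import Summits.ResolutionOfSingularities.ResolutionOfSingularities.Theorems.WeightedInvariantLocalWeightedDropWildMonicFlagDropAxisN0FirstOfPackage
import Summits.ResolutionOfSingularities.ResolutionOfSingularities.Theorems.WeightedInvariantLocalWeightedDropWildMonicFlagDropAxisN0Second

/-!
# `WeightedInvariant.LocalWeightedDrop`, line `hasse-ridge-face-selection`, S3ρ: Uk-ρD1 — `axisPackageN0_holds` (THE CANONICAL `n = 0`
# FLAG PAIR OF AN AXIS STEP EXISTS) and the child-flag types N0-FIRST / N0-SECOND of the axis drop BY NAME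

Crux item stmt-ResolutionOfSingularities-8899 `LocalWeightedDrop` (route `ResolutionOfSingularities/WeightedInvariant`), engine of the door
`HypersurfaceCentreConstruction` stmt-ResolutionOfSingularities-19897.  [OURS · L1 W4.3, chain w43, res-D-pv-005 AS res-L1-w43-stub-7: the
ASSEMBLY (f) of Uk-ρD1 per res-type-083's CUT 2026-08-27T09:03Z and my item map 09:52Z, over the landed items (i) `isMMax_zero_of_isWClean`,
(ii)(iii)(vii-`sFlag`) `…FlagDropAxisN0ChildMax`, (iv)(vi) `…FlagDropAxisN0Transport`, (v) res-type-083's `facePoint_of_kept`, (vii-companion)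
res-L1-w43-stub-3's `sValue_le_sValue_of_sFlag_le`, (b) res-D-pv-056's `isSClean_axisSucc_iff`, (d)(e) `…FlagDropAxisN0Parent`, the kept
corner res-type-013's `…FlagDropAxisN0Setting`; «flag line =
tools, finish in-flight» (res-L1-w43-plan-1 RULING gen 9 #7).  MAP: S. Perlega, arXiv:2011.14443 Prop. 9.1.1 (`n_F = 0`), Prop. 7.4.5, Lemma 9.1.2,
Prop. 9.1.4 cases (1); every object OURS; not a statement of H. Hironaka's manuscript [claim: Hironaka2017, status: under-review].]

THE PAIR.  Parent `g₀` := the representative of `…FlagDropAxisN0Parent.exists_parent_rep` for the weights `(1,1), (1,0), (0,1), (1,2)` and the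
`ρ`-source weight `(M+1, 2M+1)`, `M` above the order of every re-centring of the child (`exists_deltaL_shift_lt`).  Child `g₀′`: if the INDUCED
hypersurface `g_I` of `g₀` (`…N0Transport.exists_induced_hypersurface`) KEEPS `d`, then `g₀′ := g_I` (items by transport: validity, `d`- and `s`-
maximality from the transported cleanness, Prop. 6.1.1 (2) / 6.1.3 (2); the face point from the corner `(0, δ)` of the kept step,
res-type-013's `exists_corner_of_kept` (`…FlagDropAxisN0Setting`, p525418); `s`-maximality in the companion reading by monotonicity of `sValue` in `sFlag`; the branch `s = ⊤` of the parent gives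
`s′ = ⊤`); if `g_I` DROPS `d`, then `g₀′ :=` the child's OWN `s`-maximal clean representative (`exists_parent_rep` at the child): it has the residual
order of `g_I` (both valid and `d`-maximal), so (iv) holds and the kept-hypothesis of (v)/(vi) is void.

* `exists_deltaL_shift_lt` — off `Exit₃` the orders `δ(shift d C g)` of all re-centrings are bounded (by the `(1,1)`-clean maximum);
* `axisPackageN0_holds` — `AxisPackageN0 d p k` over a perfect field of characteristic `p`;
* `dropAxisN0First`, `dropAxisN0Second` — the two `n = 0` child-flag types of `…FlagDropAxisSplit`, by res-type-083's / res-type-013's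
  `dropAxisN0First_of_package` / `dropAxisN0Second_of_package`.
-/

set_option linter.dupNamespace false -- mandated namespace of this single-conjunct summit

noncomputable section

namespace Summit.ResolutionOfSingularities.ResolutionOfSingularities.Theorems

namespace WildMonic

open MvPowerSeries MonicDescent Literature.AlgebraicGeometry.Resolution
open PurePowerFlag (succE IsN0)

variable {k : Type} [Field k] {d : ℕ}

/-! ## §1 A bound for the orders of the re-centrings of a position -/

section Bound

variable (p : ℕ) [Fact p.Prime] [CharP k p] [PerfectRing k p]

/-- OFF `Exit₃` THE ORDERS OF ALL RE-CENTRINGS ARE BOUNDED: `δ(shift d C g) < M` for one `M` and every `g` with `g(0) = 0` (the `(1,1)`-clean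
representative has the maximal, finite `m_{(1,1)}`, Prop. 5.1.3 / 5.1.5).  Fixes the `ρ`-weight `(M+1, M)` of item (v) before the parent is cleaned. -/
theorem exists_deltaL_shift_lt (hd : 0 < d) {C : Fin d → MvPowerSeries (Fin 2) k} (hC : IsPos d C) (hex : ¬ Exit₃ p d C) :
    ∃ M : ℕ, ∀ g : MvPowerSeries (Fin 2) k, constantCoeff g = 0 → deltaL (newtonSet (shift d C g)) < M := by
  have hC0 : ∀ j, constantCoeff (C j) = 0 := constantCoeff_eq_zero_of_isPos hC
  have hnz : ∀ g : MvPowerSeries (Fin 2) k, constantCoeff g = 0 → (newtonSet (shift d C g)).Nonempty :=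
    fun g hg => newtonSet_shift_nonempty_of_not_exit₃ hex hg
  have hempty : newtonSet (0 : Fin d → MvPowerSeries (Fin 2) k) = ∅ := (newtonSet_eq_empty_iff _).2 fun _ => rfl
  obtain ⟨gc, hgc, -, hor⟩ := exists_shift_isWClean_list p hd C hC0 [![1, 1]]
  rcases hor with ⟨hcl, -⟩ | hz
  swap
  · exfalso
    have hN := hnz gc hgc
    rw [hz, hempty] at hN
    exact Set.not_nonempty_empty hN
  have hne : shift d C gc ≠ 0 := fun h => by
    have hN := hnz gc hgc
    rw [h, hempty] at hN
    exact Set.not_nonempty_empty hN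
  have hfin : wMin ![1, 1] (shift d C gc) ≠ ⊤ := wMin_ne_top_of_ne_zero _ hne
  refine ⟨(wMin ![1, 1] (shift d C gc)).toNat + 1, fun g hg => ?_⟩
  have hle := wMin_shift_le_of_isWClean_shift p ![1, 1] C (hcl _ (by simp)) hfin g
  rw [deltaL_newtonSet]
  have h := ENat.toNat_le_toNat hle hfin
  omega

end Bound

/-! ## §2 The package -/

section Package

variable (p : ℕ) [Fact p.Prime] [CharP k p] [PerfectRing k p]

/-- **`AxisPackageN0 d p k` HOLDS over a perfect field of characteristic `p`** (Uk-ρD1 (a), Per17 Prop. 9.1.1 (`n_F = 0`) + Prop. 7.4.5 +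
Lemma 9.1.2 in game form): every charged axis step has a canonical `n = 0` flag pair with the seven properties of `…FlagDropAxisPackage`.
See the module docstring for the choice of the pair. -/
theorem axisPackageN0_holds : AxisPackageN0 d p k := by
  intro A E T φ' hstep
  obtain ⟨hA, hexA, hT, hφ', hC, hexC⟩ := hstep
  -- `d > 0` (else the zero tuple is an exit)
  have hd : 0 < d := by
    rcases Nat.eq_zero_or_pos d with h0 | h
    · subst h0; exact absurd (exit₃_of_eq_zero hA fun j => j.elim0) hexA
    · exact h
  have hnzA : ∀ g : MvPowerSeries (Fin 2) k, constantCoeff g = 0 → (newtonSet (shift d A g)).Nonempty :=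
    fun g hg => newtonSet_shift_nonempty_of_not_exit₃ hexA hg
  have hnzC : ∀ g : MvPowerSeries (Fin 2) k, constantCoeff g = 0 → (newtonSet (shift d (shift d T φ') g)).Nonempty :=
    fun g hg => newtonSet_shift_nonempty_of_not_exit₃ hexC hg
  have hneC : ∀ g : MvPowerSeries (Fin 2) k, constantCoeff g = 0 → (newtonSet (flagTuple d (shift d T φ') g 0)).Nonempty :=
    fun g hg => newtonSet_flagTuple_zero_nonempty_of_not_exit₃ hexC hg
  -- the `ρ`-weight of item (v), fixed before cleaning
  obtain ⟨M, hM⟩ := exists_deltaL_shift_lt p hd hC hexC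
  -- THE PARENT REPRESENTATIVE
  have hws0 : ∀ w ∈ [![1, 1], ![1, 0], ![0, 1], ![1, 2], srcWeight (fun i : Fin 2 => if i = 0 then M + 1 else M)], 0 < w 0 + w 1 := by
    intro w hw
    simp only [List.mem_cons, List.mem_nil_iff, or_false] at hw
    rcases hw with rfl | rfl | rfl | rfl | rfl <;> simp [srcWeight]
  obtain ⟨g₀, hg₀, hws, hδpos, hmono, hsor⟩ := exists_parent_rep p hd E A hA hexA _ hws0 (by simp) (by simp) (by simp)
  have h11P : IsWClean p ![1, 1] (flagTuple d A g₀ 0) := by rw [flagTuple_zero_shear]; exact hws _ (by simp)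
  have h10P : IsWClean p ![1, 0] (flagTuple d A g₀ 0) := by rw [flagTuple_zero_shear]; exact hws _ (by simp)
  have h01P : IsWClean p ![0, 1] (flagTuple d A g₀ 0) := by rw [flagTuple_zero_shear]; exact hws _ (by simp)
  have h12P : IsWClean p ![1, 2] (flagTuple d A g₀ 0) := by rw [flagTuple_zero_shear]; exact hws _ (by simp)
  have hρP : IsWClean p (srcWeight (fun i : Fin 2 => if i = 0 then M + 1 else M)) (flagTuple d A g₀ 0) := by
    rw [flagTuple_zero_shear]; exact hws _ (by simp)
  have hδposP : 0 < dRes E (newtonSet (flagTuple d A g₀ 0)) := by rw [flagTuple_zero_shear]; exact hδpos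
  have hNP : (newtonSet (flagTuple d A g₀ 0)).Nonempty := newtonSet_flagTuple_zero_nonempty_of_not_exit₃ hexA hg₀
  have hLP : ∀ P ∈ newtonSet (flagTuple d A g₀ 0), d.factorial ≤ P 0 + P 1 :=
    fun P hP => factorial_le_of_mem_newtonSet_flagTuple_zero hA hg₀ hP
  have hσ : ∀ j : Fin d, ((d - (j : ℕ) : ℕ) : ℕ∞) ≤ (flagTuple d A g₀ 0 j).order := fun j => le_order_flagTuple hA hg₀ (map_zero _) j
  -- (i) the parent flag is valid
  have hvalP : IsMMax d A E g₀ 0 := isMMax_zero_of_isWClean p E A hnzA hg₀ (fun _ => hws _ (by simp)) (fun _ => hws _ (by simp))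
  -- THE INDUCED CHILD HYPERSURFACE
  have hlin := coeff_X₀_eq_zero_of_wMin_le hd hA hmono
  obtain ⟨gI, hgI, hind⟩ := exists_induced_hypersurface hT hφ' hg₀ hlin
  have h10I : IsWClean p ![1, 0] (flagTuple d (shift d T φ') gI 0) := by
    rw [isWClean_induced_iff p hA hg₀ hind, srcWeight_one_zero]; exact h11P
  have h01I : IsWClean p ![0, 1] (flagTuple d (shift d T φ') gI 0) := by
    rw [isWClean_induced_iff p hA hg₀ hind, srcWeight_zero_one]; exact h01P
  have h11I : IsWClean p ![1, 1] (flagTuple d (shift d T φ') gI 0) := by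
    rw [isWClean_induced_iff p hA hg₀ hind, srcWeight_one_one]; exact h12P
  have hρI : IsWClean p (fun i : Fin 2 => if i = 0 then M + 1 else M) (flagTuple d (shift d T φ') gI 0) := by
    rw [isWClean_induced_iff p hA hg₀ hind]; exact hρP
  -- (ii) the induced flag is valid, (iii) `d`-maximal, (iv) `d′ ≤ d`
  have hvalI : IsMMax d (shift d T φ') (succE (0 : k) E) gI 0 := isMMax_induced p hA hg₀ hgI hind hnzC E h11P (fun _ => h01P)
  have hdmaxI : ∀ g : MvPowerSeries (Fin 2) k, constantCoeff g = 0 → IsMMax d (shift d T φ') (succE (0 : k) E) g 0 →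
      dRes (succE (0 : k) E) (newtonSet (flagTuple d (shift d T φ') g 0)) ≤
        dRes (succE (0 : k) E) (newtonSet (flagTuple d (shift d T φ') gI 0)) :=
    fun g hg hval => dRes_le_induced_of_isMMax p hA hg₀ hgI hind hnzC E h12P hg hval
  have hdleI : dRes (succE (0 : k) E) (newtonSet (flagTuple d (shift d T φ') gI 0)) ≤ dRes E (newtonSet (flagTuple d A g₀ 0)) :=
    dRes_induced_le hA hg₀ hind hexA E
  -- the exceptional exponents of a valid child hypersurface are those of `gI`
  have hrI : ∀ g : MvPowerSeries (Fin 2) k, constantCoeff g = 0 → IsMMax d (shift d T φ') (succE (0 : k) E) g 0 →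
      excExp (succE (0 : k) E) (newtonSet (flagTuple d (shift d T φ') g 0)) =
        excExp (succE (0 : k) E) (newtonSet (flagTuple d (shift d T φ') gI 0)) := by
    intro g hg hval
    rw [flagTuple_zero_shear, flagTuple_zero_shear]
    exact excExp_shift_eq_of_isMMax p (succE (0 : k) E) (shift d T φ') hnzC hgI
      (fun _ => by rw [← flagTuple_zero_shear]; exact h10I) (fun _ => by rw [← flagTuple_zero_shear]; exact h01I) hg hval
  by_cases hkeep : dRes (succE (0 : k) E) (newtonSet (flagTuple d (shift d T φ') gI 0)) = dRes E (newtonSet (flagTuple d A g₀ 0))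
  · /- KEPT: the pair `(g₀, gI)` -/
    have hkeep' : dRes (excNext E) (psi d.factorial '' newtonSet (flagTuple d A g₀ 0)) = dRes E (newtonSet (flagTuple d A g₀ 0)) := by
      rw [← succE_zero_eq_excNext (k := k), ← newtonSet_induced hA hg₀ hind]; exact hkeep
    -- the corner of the kept step, on the child set
    have hcorner : ∃ P' ∈ newtonSet (flagTuple d (shift d T φ') gI 0),
        P' 0 = excExp (succE (0 : k) E) (newtonSet (flagTuple d (shift d T φ') gI 0)) 0 ∧
          P' 0 + P' 1 = deltaL (newtonSet (flagTuple d (shift d T φ') gI 0)) := by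
      rw [newtonSet_induced hA hg₀ hind, succE_zero_eq_excNext]
      exact exists_corner_of_kept E hNP hLP hkeep'
    -- `s′ + δ! = s`
    have hsI : sFlag (succE (0 : k) E) (newtonSet (flagTuple d (shift d T φ') gI 0)) +
        ((dRes E (newtonSet (flagTuple d A g₀ 0))).factorial : ℕ∞) = sFlag E (newtonSet (flagTuple d A g₀ 0)) := by
      rw [newtonSet_induced hA hg₀ hind, succE_zero_eq_excNext]
      exact sFlag_excNext_image_psi E hNP hLP hkeep'
    have hMI : deltaL (newtonSet (flagTuple d (shift d T φ') gI 0)) < M := by rw [flagTuple_zero_shear]; exact hM gI hgI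
    refine ⟨g₀, gI, hg₀, hgI, hvalP, hvalI, hdmaxI, hdleI, ?_, ?_, ?_⟩
    · -- (v) the face point of every valid child hypersurface of the kept class
      intro hk g hg hval hdg
      obtain ⟨P', hP', hP'0, hP'd⟩ := hcorner
      have hpos : 0 < dRes (succE (0 : k) E) (newtonSet (flagTuple d (shift d T φ') g 0)) := by rw [hdg, hk]; exact hδposP
      exact facePoint_of_kept p (shift d T φ') (succE (0 : k) E) hMI hρI hP' hP'd hP'0 (hrI g hg hval) hdg (hneC g hg) (hneC gI hgI) hpos
    · -- (vi) `s′ < s` or `s = ⊤`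
      intro hk
      exact sValue_induced_lt_or hA hg₀ hind hexA E hδposP hk
    · -- (vii) `s`-maximality of the induced flag at the child
      intro g hg hval hdg
      have hpos : 0 < dRes (succE (0 : k) E) (newtonSet (flagTuple d (shift d T φ') g 0)) := by rw [hdg, hkeep]; exact hδposP
      refine sValue_le_sValue_of_sFlag_le _ _ hdg (hrI g hg hval) hpos ?_
      rcases hsor with htop | ⟨hsc, s, hs, -⟩
      · -- the parent class has `s = ⊤`: so has the induced child
        have htopI : sFlag (succE (0 : k) E) (newtonSet (flagTuple d (shift d T φ') gI 0)) = ⊤ := by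
          by_contra hne
          obtain ⟨m, hm⟩ := ENat.ne_top_iff_exists.mp hne
          rw [← hm, flagTuple_zero_shear A g₀, htop, ← Nat.cast_add] at hsI
          exact ENat.coe_ne_top _ hsI
        rw [htopI]; exact le_top
      · -- the parent is secondary clean with finite `s`: so is the induced child (Prop. 6.1.3 (2)), and Prop. 5.2.5 applies
        rw [flagTuple_zero_shear A g₀] at hsI
        rw [hs] at hsI
        have hfinI : sFlag (succE (0 : k) E) (newtonSet (flagTuple d (shift d T φ') gI 0)) ≠ ⊤ := by
          intro ht; rw [ht, top_add] at hsI; exact ENat.top_ne_coe _ hsI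
        obtain ⟨s', hs'⟩ := ENat.ne_top_iff_exists.mp hfinI
        have hscI : IsSClean p (succE (0 : k) E) (flagTuple d (shift d T φ') gI 0) := by
          rw [succE_zero_eq_excNext]
          refine (isSClean_axisSucc_iff (flagTuple d A g₀ 0) (flagTuple d (shift d T φ') gI 0) hind p E hσ hNP ?_).mpr ?_
          · rw [← succE_zero_eq_excNext (k := k)]; exact hkeep
          · rw [flagTuple_zero_shear]; exact hsc
        calc sFlag (succE (0 : k) E) (newtonSet (flagTuple d (shift d T φ') g 0)) ≤ s' :=
              sFlag_le_induced_of_isMMax p hA hg₀ hgI hind hnzC E h11P (fun _ => h01P) hs'.symm hscI hg hval hdg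
          _ = sFlag (succE (0 : k) E) (newtonSet (flagTuple d (shift d T φ') gI 0)) := hs'
  · /- NOT KEPT: the child's own `s`-maximal clean representative -/
    have hws0' : ∀ w ∈ [![1, 1], ![1, 0], ![0, 1]], 0 < w 0 + w 1 := by
      intro w hw
      simp only [List.mem_cons, List.mem_nil_iff, or_false] at hw
      rcases hw with rfl | rfl | rfl <;> simp
    obtain ⟨gC, hgC, hwsC, hδposC, -, hsorC⟩ :=
      exists_parent_rep p hd (succE (0 : k) E) (shift d T φ') hC hexC _ hws0' (by simp) (by simp) (by simp)
    -- (ii) valid, (iii) `d`-maximal, same exceptional exponents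
    have hvalC : IsMMax d (shift d T φ') (succE (0 : k) E) gC 0 :=
      isMMax_zero_of_isWClean p (succE (0 : k) E) (shift d T φ') hnzC hgC (fun _ => hwsC _ (by simp)) (fun _ => hwsC _ (by simp))
    have hdmaxC : ∀ g : MvPowerSeries (Fin 2) k, constantCoeff g = 0 → IsMMax d (shift d T φ') (succE (0 : k) E) g 0 →
        dRes (succE (0 : k) E) (newtonSet (flagTuple d (shift d T φ') g 0)) ≤
          dRes (succE (0 : k) E) (newtonSet (flagTuple d (shift d T φ') gC 0)) := by
      intro g hg hval
      rw [flagTuple_zero_shear, flagTuple_zero_shear]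
      exact dRes_shift_le_of_isMMax p (succE (0 : k) E) (shift d T φ') hnzC hgC (hwsC _ (by simp)) hg hval
    have hrC : ∀ g : MvPowerSeries (Fin 2) k, constantCoeff g = 0 → IsMMax d (shift d T φ') (succE (0 : k) E) g 0 →
        excExp (succE (0 : k) E) (newtonSet (flagTuple d (shift d T φ') g 0)) =
          excExp (succE (0 : k) E) (newtonSet (flagTuple d (shift d T φ') gC 0)) := by
      intro g hg hval
      rw [flagTuple_zero_shear, flagTuple_zero_shear]
      exact excExp_shift_eq_of_isMMax p (succE (0 : k) E) (shift d T φ') hnzC hgC (fun _ => hwsC _ (by simp)) (fun _ => hwsC _ (by simp))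
        hg hval
    -- `gC` has the residual order of the induced `gI`, so it does not keep `d`
    have hCI := hdmaxI gC hgC hvalC
    have hIC := hdmaxC gI hgI hvalI
    have hnot : dRes (succE (0 : k) E) (newtonSet (flagTuple d (shift d T φ') gC 0)) ≠ dRes E (newtonSet (flagTuple d A g₀ 0)) := by
      intro h; apply hkeep; omega
    refine ⟨g₀, gC, hg₀, hgC, hvalP, hvalC, hdmaxC, hCI.trans hdleI, fun h => absurd h hnot, fun h => absurd h hnot, ?_⟩
    -- (vii) `s`-maximality at the child
    intro g hg hval hdg
    have hpos : 0 < dRes (succE (0 : k) E) (newtonSet (flagTuple d (shift d T φ') g 0)) := by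
      rw [hdg, flagTuple_zero_shear]; exact hδposC
    refine sValue_le_sValue_of_sFlag_le _ _ hdg (hrC g hg hval) hpos ?_
    rw [flagTuple_zero_shear, flagTuple_zero_shear] at hdg ⊢
    rcases hsorC with htop | ⟨-, s, hs, hsmax⟩
    · rw [htop]; exact le_top
    · rw [hs]
      have hr := hrC g hg hval
      rw [flagTuple_zero_shear, flagTuple_zero_shear] at hr
      exact hsmax g hg hr hdg

/-! ## §3 The two `n = 0` child-flag types of the axis drop, by name -/

/-- **TYPE N0-FIRST OF THE AXIS DROP** [Per17 Prop. 9.1.4 case (1)]: every valid first-orientation child flag `(g, h)` with `IsN0` at an axis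
point is dominated by a valid first-orientation parent flag (res-type-083's `dropAxisN0First_of_package` on `axisPackageN0_holds`). -/
theorem dropAxisN0First : DropAxisN0First d p k := dropAxisN0First_of_package (axisPackageN0_holds p)

/-- **TYPE N0-SECOND OF THE AXIS DROP** [Per17 Lemma 9.1.2]: the child flag along the new exceptional curve never wins (res-type-013's
`dropAxisN0Second_of_package` on `axisPackageN0_holds`). -/
theorem dropAxisN0Second : DropAxisN0Second d p k := dropAxisN0Second_of_package (axisPackageN0_holds p)

end Package

end WildMonic

end Summit.ResolutionOfSingularities.ResolutionOfSingularities.Theorems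

end
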